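import Literature.Barriers.Schanuel.AlgebraicIndependenceOfLogarithmsThm4FromThm2B
import HarnessLib

/-!
# Barrier (Schanuel): Roy 1992, Theorem 2 ⇒ Theorem 4 — conditions (4) and (5) of p. 35

Fourth support file for the deduction of Roy's Theorem 4 (`roy1992_thm4`) from his Theorem 2
(`roy1992_thm2`) [Roy1992, §4 pp. 34–37]. In the case `d' = d` of the printed proof one has the
minimality property

  (2) `dim_K(t₁(U))/d₁ ≥ dim_K(U)/d` for each surjective `K`-linear `t₁ : K^d → K^{d₁}` rational
      over `ℚ̄` and non-zero (`Roy1992.IsMinimalTwo`),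

and Theorem 2 is applied to the object `(K^d × (K^d)^m, Y, W, V)`, `V = φ⁻¹(U)`, with the identity
as the chosen map: "Let us show that we can choose the identity mapping of `K^d × (K^d)^m` to apply
this theorem. This amounts on the one hand to showing (4) `V ∩ (ℚ̄^d × 0) = 0`, and on the other
hand to showing (5) `md/(d + md − dim_K(V)) ≤ d₁'/(d₀' + d₁' − dim_K(s(V)))` for each surjective
`K`-linear mapping `s : K^d × (K^d)^m → K^{d₀'} × K^{d₁'}` satisfying `s(ℚ̄^d × 0) ⊆ ℚ̄^{d₀'} × 0`,
`s(0 × (ℚ^d)^m) ⊆ 0 × ℚ^{d₁'}`, `s(V) ≠ K^{d₀'} × K^{d₁'}`" [Roy1992, p. 35]. This file proves both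
from (2):

* `Roy1992.fPoints_eq_bot_of_minimal` — (4) in the form `U ∩ ℚ̄^d = 0` (p. 36: with
  `T = K·(U ∩ ℚ̄^d) ⊆ U` and `t₁` a rational surjection with kernel `T`, "(2) applied to this
  choice of `t₁` gives `dim_K(T) = 0`").
* `Roy1992.thm2Ratio_id_le` — (5), following pp. 35–36: `ker s = S₀ × S₁`
  (`exists_eq_prodMap_of_isAdmissible`); `T = φ(S₀ × S₁)` is rational over `ℚ̄`
  (`Roy1992.map_phi_prod_eq_spanK`); `t₁` = a rational surjection with kernel `T`; the count
  "`dim_K(S₁) = dim_ℚ(S) = dim_ℚ(φ(0 × S)) ≤ m dim_k(T ∩ k^d) ≤ m dim_K(T)`, whence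
  `d₁' ≥ m(d − dim_K(T)) = md₁`" (`Roy1992.finrank_le_mul_finrank_of_psi_mem`); and the identities
  (6) `d + md − dim_K(V) = d − dim_K(U)`, `d₀' + d₁' − dim_K(s(V)) = d₁ − dim_K(t₁(U))`.

Everything is proved; no new facts.

## References

* [Roy1992] D. Roy, *Matrices whose coefficients are linear forms in logarithms*, J. Number
  Theory 41 (1992) 22–47: §4, proof of Theorem 4, (2), (4), (5), (6), pp. 34–36.
-/

noncomputable section

open Module Submodule Complex

namespace Literature.Barriers.Schanuel.Roy1992

variable {d : ℕ}

/-- Roy's minimality property (2) of `U ⊆ K^d` (case `d' = d` of the proof of Theorem 4):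
`dim_K(U)/d ≤ dim_K(t₁(U))/d₁` for every surjective non-zero `t₁ : K^d → K^{d₁}` rational over `ℚ̄`.
[cite: Roy1992, §4 proof of Theorem 4, (2) (p. 34)] -/
def IsMinimalTwo (d : ℕ) (U : Submodule ℂ (Fin d → ℂ)) : Prop :=
  ∀ (d₁ : ℕ) (t₁ : (Fin d → ℂ) →ₗ[ℂ] (Fin d₁ → ℂ)), Function.Surjective t₁ → IsRationalMap t₁ →
    t₁ ≠ 0 → (finrank ℂ U : ℝ) / d ≤ (finrank ℂ (U.map t₁) : ℝ) / d₁

/-- A surjection onto `K^{d₁}` with `d₁ > 0` is non-zero. [folklore] -/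
theorem ne_zero_of_surjective {d₁ : ℕ} (hd₁ : 0 < d₁) {t : (Fin d → ℂ) →ₗ[ℂ] (Fin d₁ → ℂ)}
    (ht : Function.Surjective t) : t ≠ 0 := by
  intro h
  obtain ⟨w, hw⟩ := ht fun _ => 1
  have := congrFun hw ⟨0, hd₁⟩
  simp [h] at this

/-- Cross-multiplied form of `u/d ≤ (a − τ)/(d − τ)` (`τ < d`, `0 < d`). [folklore] -/
theorem key_ineq {u a τ dd : ℝ} (hd : 0 < dd) (hτ : τ < dd)
    (h : u / dd ≤ (a - τ) / (dd - τ)) : u * (dd - τ) ≤ dd * (a - τ) := by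
  rw [div_le_div_iff₀ hd (by linarith)] at h
  linarith

/-! ### (4): `U` has no non-zero `ℚ̄`-points -/

/-- **(4) `U ∩ ℚ̄^d = 0`**: if `U ≠ K^d` satisfies the minimality (2) then `U` contains no non-zero
vector with algebraic coordinates (p. 36: with `T = K·(U ∩ ℚ̄^d) ⊆ U` and `t₁` a rational
surjection with kernel `T`, (2) gives `dim_K(T) = 0`).
[cite: Roy1992, §4 proof of Theorem 4, (4) (p. 36)] -/
theorem fPoints_eq_bot_of_minimal (hd : 0 < d) {U : Submodule ℂ (Fin d → ℂ)} (hU : U ≠ ⊤)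
    (hmin : IsMinimalTwo d U) : fPoints (F := (algebraicClosure ℚ ℂ)) U = ⊥ := by
  by_contra hne
  have hτ0 : 0 < finrank (algebraicClosure ℚ ℂ) (fPoints (F := (algebraicClosure ℚ ℂ)) U) := by
    rw [pos_iff_ne_zero, Ne, Submodule.finrank_eq_zero]
    exact hne
  obtain ⟨d₁, A, hdim, hsurj, hker⟩ := exists_surjective_ker_eq_spanK (K := ℂ) (fPoints (F := (algebraicClosure ℚ ℂ)) U)
  have hTU : LinearMap.ker (A.map (algebraMap (algebraicClosure ℚ ℂ) ℂ)).mulVecLin ≤ U := by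
    rw [hker]; exact spanK_fPoints_le U
  have hTfin : finrank ℂ (LinearMap.ker (A.map (algebraMap (algebraicClosure ℚ ℂ) ℂ)).mulVecLin) =
      finrank (algebraicClosure ℚ ℂ) (fPoints (F := (algebraicClosure ℚ ℂ)) U) := by rw [hker, finrank_spanK]
  have hu : finrank ℂ U < d := by
    have := Submodule.finrank_lt hU
    simpa using this
  have hτu : finrank (algebraicClosure ℚ ℂ) (fPoints (F := (algebraicClosure ℚ ℂ)) U) ≤ finrank ℂ U :=
    hTfin ▸ Submodule.finrank_mono hTU
  have hd₁ : 0 < d₁ := by omega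
  have hmap : finrank ℂ (U.map (A.map (algebraMap (algebraicClosure ℚ ℂ) ℂ)).mulVecLin) +
      finrank (algebraicClosure ℚ ℂ) (fPoints (F := (algebraicClosure ℚ ℂ)) U) = finrank ℂ U := by
    rw [← hTfin, finrank_map_add_finrank_ker, sup_eq_left.2 hTU]
  have h := hmin d₁ _ hsurj (isRationalMap_mulVecLin_map A) (ne_zero_of_surjective hd₁ hsurj)
  have hd₁' : (d₁ : ℝ) = d - finrank (algebraicClosure ℚ ℂ) (fPoints (F := (algebraicClosure ℚ ℂ)) U) := by
    have : (d₁ : ℝ) + finrank (algebraicClosure ℚ ℂ) (fPoints (F := (algebraicClosure ℚ ℂ)) U) = d := by exact_mod_cast hdim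
    linarith
  have hmap' : (finrank ℂ (U.map (A.map (algebraMap (algebraicClosure ℚ ℂ) ℂ)).mulVecLin) : ℝ) =
      finrank ℂ U - finrank (algebraicClosure ℚ ℂ) (fPoints (F := (algebraicClosure ℚ ℂ)) U) := by
    have : (finrank ℂ (U.map (A.map (algebraMap (algebraicClosure ℚ ℂ) ℂ)).mulVecLin) : ℝ) +
        finrank (algebraicClosure ℚ ℂ) (fPoints (F := (algebraicClosure ℚ ℂ)) U) = finrank ℂ U := by exact_mod_cast hmap
    linarith
  rw [hd₁', hmap'] at h
  have hdR : (0 : ℝ) < d := by exact_mod_cast hd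
  have hτR : (finrank (algebraicClosure ℚ ℂ) (fPoints (F := (algebraicClosure ℚ ℂ)) U) : ℝ) < d := by
    exact_mod_cast (lt_of_le_of_lt hτu hu)
  have hk := key_ineq hdR hτR h
  have hτpos : (0 : ℝ) < finrank (algebraicClosure ℚ ℂ) (fPoints (F := (algebraicClosure ℚ ℂ)) U) := by exact_mod_cast hτ0
  have huR : (finrank ℂ U : ℝ) < d := by exact_mod_cast hu
  nlinarith

/-! ### (5): the identity minimises Roy's ratio -/

section Five

variable {m : ℕ} {k : IntermediateField ℚ ℂ} (η : Basis (Fin m) ℚ k) [FiniteDimensional ℚ k]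

/-- The basis elements as algebraic numbers. [folklore] -/
def etaQbar (μ : Fin m) : (algebraicClosure ℚ ℂ) := ⟨((η μ : k) : ℂ), eta_mem_algebraicClosure η μ⟩

/-- `ψ` at the level `ℚ^{md} → ℚ̄^d`. [cite: Roy1992, §4 proof of Theorem 4 (p. 36)] -/
def psiQbar : (Fin (m * d) → ℚ) →ₗ[ℚ] (Fin d → (algebraicClosure ℚ ℂ)) :=
  (psi (etaQbar η)).restrictScalars ℚ ∘ₗ incl ℚ (algebraicClosure ℚ ℂ) (m * d)

/-- `ψ` at the level `ℚ^{md} → k^d`. [cite: Roy1992, §4 proof of Theorem 4 (p. 36)] -/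
def psiK : (Fin (m * d) → ℚ) →ₗ[ℚ] (Fin d → k) :=
  (psi fun μ => (η μ : k)).restrictScalars ℚ ∘ₗ incl ℚ k (m * d)

omit [FiniteDimensional ℚ k] in
/-- `ψ_K` is injective. [cite: Roy1992, §4 proof of Theorem 4 (p. 36)] -/
theorem psiK_injective : Function.Injective (psiK (d := d) η) := by
  rw [← LinearMap.ker_eq_bot, LinearMap.ker_eq_bot']
  intro y hy
  exact psi_incl_eq_zero η hy

/-- The levels agree in `ℂ^d`: `incl_ℚ̄ (ψ_ℚ̄ y) = ψ (incl_ℚ y)`. [folklore] -/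
theorem incl_psiQbar (y : Fin (m * d) → ℚ) :
    incl (algebraicClosure ℚ ℂ) ℂ d (psiQbar (d := d) η y) = psi (fun μ => ((η μ : k) : ℂ)) (incl ℚ ℂ (m * d) y) := by
  funext i
  simp only [incl_apply, psiQbar, LinearMap.comp_apply, LinearMap.restrictScalars_apply, psi_apply,
    map_sum, map_mul]
  rfl

omit [FiniteDimensional ℚ k] in
/-- `incl_k (ψ_K y) = ψ (incl_ℚ y)`. [folklore] -/
theorem incl_psiK (y : Fin (m * d) → ℚ) :
    incl k ℂ d (psiK (d := d) η y) = psi (fun μ => ((η μ : k) : ℂ)) (incl ℚ ℂ (m * d) y) := by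
  funext i
  simp only [incl_apply, psiK, LinearMap.comp_apply, LinearMap.restrictScalars_apply, psi_apply,
    map_sum, map_mul]
  exact Finset.sum_congr rfl fun μ _ => rfl

/-- **`T = φ(S₀ × S₁)` is rational over `ℚ̄`**: for `S₀ = ker A₀` (`A₀` over `ℚ̄`) and `S₁ = ker A₁`
(`A₁` over `ℚ`), `φ(S₀ × S₁) = spanK_ℚ̄ (ker A₀ + span_ℚ̄ ψ_ℚ̄(ker A₁))`.
[cite: Roy1992, §4 proof of Theorem 4 (p. 35)] -/
theorem map_phi_prod_eq_spanK {d₀' d₁' : ℕ} (A₀ : Matrix (Fin d₀') (Fin d) (algebraicClosure ℚ ℂ))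
    (A₁ : Matrix (Fin d₁') (Fin (m * d)) ℚ) :
    ((LinearMap.ker (A₀.map (algebraMap (algebraicClosure ℚ ℂ) ℂ)).mulVecLin).prod
        (LinearMap.ker (A₁.map (algebraMap ℚ ℂ)).mulVecLin)).map (phi η) =
      spanK ℂ (LinearMap.ker A₀.mulVecLin ⊔
        Submodule.span (algebraicClosure ℚ ℂ) (psiQbar η '' (LinearMap.ker A₁.mulVecLin : Set (Fin (m * d) → ℚ)))) := by
  rw [ker_mulVecLin_map A₀, ker_mulVecLin_map A₁]
  apply le_antisymm
  · rw [Submodule.map_le_iff_le_comap]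
    rintro ⟨x, y⟩ ⟨hx, hy⟩
    rw [Submodule.mem_comap, phi_apply]
    refine add_mem ?_ ?_
    · exact Submodule.span_mono (Set.image_mono fun z hz => Submodule.mem_sup_left hz) hx
    · have hψy := Submodule.mem_map_of_mem (f := psi fun μ => ((η μ : k) : ℂ)) hy
      rw [spanK, Submodule.map_span] at hψy
      refine Submodule.span_le.2 ?_ hψy
      rintro _ ⟨_, ⟨y₁, hy₁, rfl⟩, rfl⟩
      refine Submodule.subset_span ⟨psiQbar η y₁, ?_, incl_psiQbar η y₁⟩
      exact Submodule.mem_sup_right (Submodule.subset_span ⟨y₁, hy₁, rfl⟩)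
  · rw [spanK, Submodule.span_le]
    rintro _ ⟨z, hz, rfl⟩
    rw [SetLike.mem_coe] at hz ⊢
    obtain ⟨x₀, hx₀, w, hw, rfl⟩ := Submodule.mem_sup.1 hz
    rw [map_add]
    refine add_mem ?_ ?_
    · refine ⟨(incl (algebraicClosure ℚ ℂ) ℂ d x₀, 0), ⟨Submodule.subset_span ⟨x₀, hx₀, rfl⟩, zero_mem _⟩, by simp⟩
    · refine Submodule.span_induction (p := fun w _ => incl (algebraicClosure ℚ ℂ) ℂ d w ∈ _) ?_ (by simp)
        (fun a b _ _ ha hb => by simpa using add_mem ha hb) (fun c w _ hw => ?_) hw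
      · rintro _ ⟨y₁, hy₁, rfl⟩
        refine ⟨(0, incl ℚ ℂ (m * d) y₁), ⟨zero_mem _, Submodule.subset_span ⟨y₁, hy₁, rfl⟩⟩, ?_⟩
        rw [phi_apply, zero_add, incl_psiQbar]
      · rw [LinearMap.map_smul, algebra_compatible_smul ℂ c]
        exact Submodule.smul_mem _ _ hw

/-- **The count `dim_K(S₁) ≤ m dim_K(T)`**: if `K₁ ⊆ ℚ^{md}` is a `ℚ`-subspace with `ψ(K₁) ⊆ T`
for a `K`-subspace `T ⊆ K^d`, then `dim_ℚ K₁ ≤ m dim_K T` ("`dim_K(S₁) = dim_ℚ(S) = dim_ℚ(φ(0 × S))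
≤ m dim_k(T ∩ k^d) ≤ m dim_K(T)`": `ψ_K` is injective, `ψ_K(K₁)` spans over `k` a subspace `R` of
`k^d` with `dim_ℚ R = m dim_k R`, and `dim_k R = dim_K spanK R ≤ dim_K T`).
[cite: Roy1992, §4 proof of Theorem 4 (p. 36)] -/
theorem finrank_le_mul_finrank_of_psi_mem (K₁ : Submodule ℚ (Fin (m * d) → ℚ))
    (T : Submodule ℂ (Fin d → ℂ))
    (hT : ∀ y ∈ K₁, psi (fun μ => ((η μ : k) : ℂ)) (incl ℚ ℂ (m * d) y) ∈ T) :
    finrank ℚ K₁ ≤ m * finrank ℂ T := by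
  set R : Submodule k (Fin d → k) := Submodule.span k (psiK η '' K₁) with hR
  have h1 : finrank ℚ K₁ = finrank ℚ (K₁.map (psiK η)) :=
    LinearEquiv.finrank_eq (Submodule.equivMapOfInjective _ (psiK_injective η) K₁)
  have h2 : K₁.map (psiK η) ≤ R.restrictScalars ℚ := by
    rw [Submodule.map_le_iff_le_comap]
    intro y hy
    exact Submodule.subset_span ⟨y, hy, rfl⟩
  have h3 : finrank ℚ (K₁.map (psiK η)) ≤ finrank ℚ (R.restrictScalars ℚ) :=
    Submodule.finrank_mono h2
  have h4 : finrank ℚ (R.restrictScalars ℚ) = m * finrank k R := by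
    rw [((Submodule.restrictScalarsEquiv ℚ k (Fin d → k) R).restrictScalars ℚ).finrank_eq,
      ← Module.finrank_mul_finrank ℚ k R, Module.finrank_eq_card_basis η, Fintype.card_fin]
  have h5 : finrank k R ≤ finrank ℂ T := by
    rw [← finrank_spanK (K := ℂ) R]
    refine Submodule.finrank_mono ?_
    rw [hR, spanK_span, Submodule.span_le]
    rintro _ ⟨_, ⟨y₁, hy₁, rfl⟩, rfl⟩
    rw [SetLike.mem_coe, incl_psiK]
    exact hT y₁ hy₁
  calc finrank ℚ K₁ = finrank ℚ (K₁.map (psiK η)) := h1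
    _ ≤ finrank ℚ (R.restrictScalars ℚ) := h3
    _ = m * finrank k R := h4
    _ ≤ m * finrank ℂ T := Nat.mul_le_mul_left m h5

set_option maxHeartbeats 400000 in
/-- **(5) The identity minimises Roy's ratio.** With `V = φ⁻¹(U)`, `U ≠ K^d` satisfying (2): for
every admissible `s` with `s(V) ≠ K^{d₀'} × K^{d₁'}`,
`md/(d + md − dim_K V) ≤ d₁'/(d₀' + d₁' − dim_K s(V))`.
[cite: Roy1992, §4 proof of Theorem 4, (5)–(6) (pp. 35–36)] -/
theorem thm2Ratio_id_le (hd : 0 < d) {U : Submodule ℂ (Fin d → ℂ)} (hU : U ≠ ⊤)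
    (hmin : IsMinimalTwo d U) {d₀' d₁' : ℕ}
    (s : LinTangent d (m * d) →ₗ[ℂ] LinTangent d₀' d₁') (hs : IsAdmissible s)
    (hsV : (U.comap (phi η)).map s ≠ ⊤) :
    thm2Ratio (U.comap (phi η)) d (m * d) LinearMap.id ≤ thm2Ratio (U.comap (phi η)) d₀' d₁' s := by
  -- `s = s₀ × s₁`, kernels and their dimensions
  obtain ⟨A₀, A₁, hsdec, hs₀, hs₁⟩ := exists_eq_prodMap_of_isAdmissible hs
  have hkers : LinearMap.ker s = (LinearMap.ker (A₀.map (algebraMap (algebraicClosure ℚ ℂ) ℂ)).mulVecLin).prod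
      (LinearMap.ker (A₁.map (algebraMap ℚ ℂ)).mulVecLin) := by
    rw [hsdec, LinearMap.ker_prodMap]
  have hκ₀ : finrank ℂ (LinearMap.ker (A₀.map (algebraMap (algebraicClosure ℚ ℂ) ℂ)).mulVecLin) =
      finrank (algebraicClosure ℚ ℂ) (LinearMap.ker A₀.mulVecLin) := by rw [ker_mulVecLin_map, finrank_spanK]
  have hκ₁ : finrank ℂ (LinearMap.ker (A₁.map (algebraMap ℚ ℂ)).mulVecLin) =
      finrank ℚ (LinearMap.ker A₁.mulVecLin) := by rw [ker_mulVecLin_map, finrank_spanK]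
  have hd₀' : d₀' + finrank (algebraicClosure ℚ ℂ) (LinearMap.ker A₀.mulVecLin) = d := by
    have h := LinearMap.finrank_range_add_finrank_ker (A₀.map (algebraMap (algebraicClosure ℚ ℂ) ℂ)).mulVecLin
    rwa [LinearMap.range_eq_top.2 hs₀, finrank_top, finrank_fin_fun, finrank_fin_fun, hκ₀] at h
  have hd₁' : d₁' + finrank ℚ (LinearMap.ker A₁.mulVecLin) = m * d := by
    have h := LinearMap.finrank_range_add_finrank_ker (A₁.map (algebraMap ℚ ℂ)).mulVecLin
    rwa [LinearMap.range_eq_top.2 hs₁, finrank_top, finrank_fin_fun, finrank_fin_fun, hκ₁] at h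
  have hkerfin : finrank ℂ (LinearMap.ker s) =
      finrank (algebraicClosure ℚ ℂ) (LinearMap.ker A₀.mulVecLin) + finrank ℚ (LinearMap.ker A₁.mulVecLin) := by
    rw [hkers, finrank_prod_eq, hκ₀, hκ₁]
  -- `T = φ(ker s)` is rational over `ℚ̄`
  set TF : Submodule (algebraicClosure ℚ ℂ) (Fin d → (algebraicClosure ℚ ℂ)) := LinearMap.ker A₀.mulVecLin ⊔
    Submodule.span (algebraicClosure ℚ ℂ) (psiQbar η '' (LinearMap.ker A₁.mulVecLin : Set (Fin (m * d) → ℚ))) with hTF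
  have hTeq : (LinearMap.ker s).map (phi η) = spanK ℂ TF := by
    rw [hkers, hTF, map_phi_prod_eq_spanK]
  have hTfin : finrank ℂ ((LinearMap.ker s).map (phi η)) = finrank (algebraicClosure ℚ ℂ) TF := by
    rw [hTeq, finrank_spanK]
  -- a rational surjection `t₁` with kernel `T`
  obtain ⟨d₁, A, hdim, hsurj, hkerA⟩ := exists_surjective_ker_eq_spanK (K := ℂ) TF
  have hkert₁ : LinearMap.ker (A.map (algebraMap (algebraicClosure ℚ ℂ) ℂ)).mulVecLin = (LinearMap.ker s).map (phi η) := by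
    rw [hkerA, hTeq]
  -- bookkeeping (6)
  have hVfin : finrank ℂ (U.comap (phi η)) = finrank ℂ U + m * d := by
    rw [finrank_comap_of_surjective _ (phi_surjective η), finrank_ker_phi]
  have hsupfin : finrank ℂ ↥(U.comap (phi η) ⊔ LinearMap.ker s) =
      finrank ℂ ↥(U ⊔ (LinearMap.ker s).map (phi η)) + m * d := by
    rw [comap_sup_eq_comap, finrank_comap_of_surjective _ (phi_surjective η), finrank_ker_phi]
  have hmaps := finrank_map_add_finrank_ker s (U.comap (phi η))
  have hmapsV : finrank ℂ ((U.comap (phi η)).map s) + d =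
      d₀' + d₁' + finrank ℂ ↥(U ⊔ (LinearMap.ker s).map (phi η)) := by
    rw [hkerfin, hsupfin] at hmaps
    omega
  have hlt : finrank ℂ ((U.comap (phi η)).map s) < d₀' + d₁' := by
    have := Submodule.finrank_lt hsV
    simpa [Module.finrank_prod] using this
  have had : finrank ℂ ↥(U ⊔ (LinearMap.ker s).map (phi η)) < d := by omega
  have hτa : finrank (algebraicClosure ℚ ℂ) TF ≤ finrank ℂ ↥(U ⊔ (LinearMap.ker s).map (phi η)) :=
    hTfin ▸ Submodule.finrank_mono le_sup_right
  have hd₁pos : 0 < d₁ := by omega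
  -- (2) for `t₁`
  have hmapt₁ : finrank ℂ (U.map (A.map (algebraMap (algebraicClosure ℚ ℂ) ℂ)).mulVecLin) + finrank (algebraicClosure ℚ ℂ) TF =
      finrank ℂ ↥(U ⊔ (LinearMap.ker s).map (phi η)) := by
    have h := finrank_map_add_finrank_ker (A.map (algebraMap (algebraicClosure ℚ ℂ) ℂ)).mulVecLin U
    rwa [hkert₁, hTfin] at h
  have h2 := hmin d₁ _ hsurj (isRationalMap_mulVecLin_map A) (ne_zero_of_surjective hd₁pos hsurj)
  -- the count `dim_ℚ ker A₁ ≤ m dim T`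
  have hkey : finrank ℚ (LinearMap.ker A₁.mulVecLin) ≤ m * finrank (algebraicClosure ℚ ℂ) TF := by
    rw [← hTfin]
    refine finrank_le_mul_finrank_of_psi_mem η _ _ fun y hy => ?_
    rw [← zero_add (psi _ _), ← phi_apply η (0, incl ℚ ℂ (m * d) y)]
    refine Submodule.mem_map_of_mem ?_
    rw [hkers]
    exact ⟨zero_mem _, by rw [ker_mulVecLin_map]; exact Submodule.subset_span ⟨y, hy, rfl⟩⟩
  -- the final computation, in `ℝ`
  have hu' : finrank ℂ U < d := by
    have := Submodule.finrank_lt hU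
    simpa using this
  set a := finrank ℂ ↥(U ⊔ (LinearMap.ker s).map (phi η)) with ha
  set u := finrank ℂ U with hu
  set τ := finrank (algebraicClosure ℚ ℂ) TF with hτ
  have hdR : (0 : ℝ) < d := by exact_mod_cast hd
  have huR : (u : ℝ) < d := by exact_mod_cast hu'
  have haR : (a : ℝ) < d := by exact_mod_cast had
  have hτR : (τ : ℝ) < d := by exact_mod_cast lt_of_le_of_lt hτa had
  have hmR : (0 : ℝ) ≤ m := by exact_mod_cast Nat.zero_le m
  have hd₁R : (d₁ : ℝ) = d - τ := by
    have : (d₁ : ℝ) + τ = d := by exact_mod_cast hdim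
    linarith
  have hft₁ : (finrank ℂ (U.map (A.map (algebraMap (algebraicClosure ℚ ℂ) ℂ)).mulVecLin) : ℝ) = a - τ := by
    have : (finrank ℂ (U.map (A.map (algebraMap (algebraicClosure ℚ ℂ) ℂ)).mulVecLin) : ℝ) + τ = a := by
      exact_mod_cast hmapt₁
    linarith
  rw [hd₁R, hft₁] at h2
  have hk : (u : ℝ) * (d - τ) ≤ d * (a - τ) := key_ineq hdR hτR h2
  have hd₁'R : (m : ℝ) * (d - τ) ≤ d₁' := by
    have h1 : (d₁' : ℝ) + finrank ℚ (LinearMap.ker A₁.mulVecLin) = m * d := by exact_mod_cast hd₁'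
    have h2' : (finrank ℚ (LinearMap.ker A₁.mulVecLin) : ℝ) ≤ m * τ := by exact_mod_cast hkey
    nlinarith
  have hden1 : (d : ℝ) + ((m * d : ℕ) : ℝ) - (finrank ℂ ((U.comap (phi η)).map LinearMap.id) : ℝ) =
      d - u := by
    rw [Submodule.map_id, hVfin]
    push_cast
    ring
  have hden2 : (d₀' : ℝ) + d₁' - (finrank ℂ ((U.comap (phi η)).map s) : ℝ) = d - a := by
    have : (finrank ℂ ((U.comap (phi η)).map s) : ℝ) + d = d₀' + d₁' + a := by exact_mod_cast hmapsV
    linarith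
  unfold thm2Ratio
  rw [hden1, hden2, div_le_div_iff₀ (by linarith) (by linarith)]
  calc ((m * d : ℕ) : ℝ) * (d - a) ≤ (m : ℝ) * (d - τ) * (d - u) := by
        push_cast
        nlinarith [mul_nonneg hmR (sub_nonneg.2 hk)]
    _ ≤ (d₁' : ℝ) * (d - u) := mul_le_mul_of_nonneg_right hd₁'R (by linarith)

end Five

end Literature.Barriers.Schanuel.Roy1992
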